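import Mathlib
import Literature.NumberTheory.Sieve.GoldstonGrahamPintzYildirimProofs
import Literature.NumberTheory.Sieve.GoldstonGrahamPintzYildirimLemma3
import Literature.NumberTheory.Sieve.MaynardSieveYm
import Literature.NumberTheory.LFunctions.ConreyIwaniec2002Thm61DivisorMoments
import Literature.NumberTheory.LFunctions.PrimeRpowTailChebyshev
import HarnessLib

/-!
# Maynard 2016 (*Dense clusters of primes in subsets*), Lemma 8.3: smoothed sums of multiplicative functions

Topic `Literature/NumberTheory/Sieve`; namespace `Literature.NumberTheory.Sieve.MaynardDense`.
J. Maynard, *Dense clusters of primes in subsets*, Compositio Math. 152 (2016), 1517–1554 = arXiv:1405.2593,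
Lemma 8.3 (p. 16 of the arXiv version): for `A₁, A₂, L > 0`, a multiplicative `γ` with
`0 ≤ γ(p)/p ≤ 1 − A₁` and `−L ≤ ∑_{w ≤ p ≤ z} γ(p) log p/p − log(z/w) ≤ A₂` (`2 ≤ w ≤ z`), the totally
multiplicative `g` with `g(p) = γ(p)/(p − γ(p))`, and a smooth `G : [0,1] → ℝ` with
`G_max = sup_{[0,1]} (|G| + |G'|)`:
`∑_{d<z} μ(d)² g(d) G(log d/log z) = c_γ log z ∫₀¹ G(x) dx + O_{A₁,A₂}(c_γ L G_max)`,
`c_γ = ∏_p (1 − γ(p)/p)⁻¹ (1 − 1/p)`.  Printed proof: «This is [GGPY], with `κ = 1` and slight changes to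
the notation.»  Here it is DERIVED from the tree's PROVED Goldston–Graham–Pintz–Yıldırım Lemma 4 (`κ = 1`),
`GGPY.moebiusSqGSum_asymptotic_holds` (Lemma 3, `GoldstonGrahamPintzYildirimLemma3.lean`) with
`GGPY.moebiusSqGSumWeighted_asymptotic_of` (Lemma 4 from Lemma 3, `GoldstonGrahamPintzYildirimProofs.lean`;
the tree's `GGPY.moebiusSqGSumWeighted_asymptotic_holds` of `MaynardSieveYmHolds.lean` is the same term), by the
change of variable `F(u) = G(1 − u)`:
`G(log d/log z) = F(log(z/d)/log z)` and `∫₀¹ F(1 − x) dx = ∫₀¹ G(x) dx`.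

Conventions (those of the tree's GGPY module): only the values `γ(p)` at primes enter; on square-free `d`
the tree's `GGPY.g γ d = ∏_{p ∣ d} γ(p)/(p − γ(p))` is the printed totally multiplicative `g` (the factor
`μ(d)²` kills the rest); `d < z` is `d < ⌈z⌉₊`; the hypotheses are the tree's `GGPY.HypOmega1 γ A₁'` (i.e.
`0 ≤ γ(p)/p ≤ 1 − 1/A₁'`, so the printed `A₁` is `1/A₁'`) and `GGPY.HypOmega2 γ 1 A₂ L` (sum over
`w ≤ p < z`); `L ≥ 1` and `z ≥ 2` as vendored there (printed: `L > 0`); `G ∈ C¹(ℝ)` (printed: smooth on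
`[0,1]`) with any `G_max ≥ sup_{[0,1]}(|G| + |G'|)`; the `O(·)` is an explicit absolute-value bound with a
constant depending on `A₁', A₂` only.

§2 is the hypotheses check (8.13)–(8.14) of the induction step of Lemma 8.4 (p. 16): for the multiplicative
`γ` with `γ(p) = 0` (`p ∣ M`, printed `M = W_{j+1} ∏_{i>j+1} e_i`) and `γ(p) = p/a_p` otherwise (printed
`a_p = 1 + n_j(p) + g(p) = p + O(k)`), with `M` a multiple of every prime `p ≤ 2K²` and `|a_p − p| ≤ K`
(`K ≥ 2`): «we can take `A₁` and `A₂` to be fixed constants (independent of `j, k, r, x`)» — here `A₁' = 2`,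
`A₂ = 13` — and «`L ≪ 1 + ∑_{p ∣ W_{j+1}∏ e_i} log p/p + ∑_{p > 2k²} k log p/p²`» — here
`L = 9 + ∑_{p ∣ M} log p/p` (`hyp_gamma84`; the tree's `sum_primeFactors_log_div_le` then gives the printed
`L ≪ log log R` for `M ≤ R^{O(k²)}`), by comparison with the tree's `γ = 1_{p ∤ M}` (`gammaInd`,
`hypOmega2_gammaInd`, Maynard 2015) and the tail `∑_{h > H} (1 + log h)/h² ≤ (2 + log H)/H`
(`ConreyIwaniec2002.Thm61DivisorMoments.sum_Ioc_log_div_sq_le`); `lemma83_gamma84` is Lemma 8.3 for this `γ`.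
§3 is the bookkeeping of the constants `c_j` of (8.11): `c_γ` under modification of `γ` at finitely many primes
(`cGamma_eq_mul_prod`), in particular `c_{γ_{ME}} = c_{γ_M} ∏_{p ∣ E, p ∤ M}(1 − 1/a_p)` for the `γ` of (8.13)
(`cGamma_gamma84_mul`), the partial products converging by the tree's proved GGPY Lemma 3
(`tendsto_cGammaPartial_gamma84`).
§4 is (8.13)–(8.14) again with the THRESHOLD decoupled from the DEVIATION, which is the form the applications
in §9 of the paper need (there `g(p) = p − ω(p) + O(1)` and `r = k`, so `|a_p − p| ≈ 2k`, while the `W_i` are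
multiples of `∏_{p ≤ 2k²} p` only): `M` a multiple of every prime `p ≤ 2K₀²` (`K₀ ≥ 2`) and `|a_p − p| ≤ K₁` with
`K₁ ≤ K₀²` give `(Ω₁)` with `A₁' = 2` and `(Ω₂)` with `A₂ = 15`, `L = 11 + ∑_{p ∣ M} log p/p` (`hyp_gamma84_dec`),
the tail now taken over PRIMES, `∑_{p > H} log p/p² ≤ 3 log 4/H` (`sum_filter_prime_gt_log_div_sq_le`, from the
tree's partial summation against Chebyshev's `ϑ(x) ≤ x log 4`, `LFunctions.sum_Ioc_prime_log_mul_rpow_le`), so that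
`2K₁ · 3 log 4/⌊2K₀²⌋ ≤ (24/7) log 4 < 5`; `lemma83_gamma84_dec` is Lemma 8.3 for this `γ` in the same shape as
`lemma83_gamma84` (error `≤ C c_γ (9 + ∑_{p ∣ M} log p/p) G_max`), and `tendsto_cGammaPartial_gamma84_dec` the
convergence of the partial products of `c_γ`.  (`hyp_gamma84` is the case `K₀ = K₁ = K`.)

## References
* J. Maynard, *Dense clusters of primes in subsets*, Compositio Math. 152 (2016), 1517–1554; arXiv:1405.2593,
  Lemma 8.3, Lemma 8.4 (proof, (8.13)–(8.14)). [Maynard2016DenseClusters]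
* D. A. Goldston, S. W. Graham, J. Pintz, C. Y. Yıldırım, *Small gaps between products of two primes*,
  Proc. Lond. Math. Soc. (3) 98 (2009), 741–774, Lemma 4. [GoldstonEtAl2008]
-/

noncomputable section

open Finset Filter Real
open scoped Topology ArithmeticFunction.Moebius

namespace Literature.NumberTheory.Sieve

namespace MaynardDense

/-! ## §1 Lemma 8.3 -/

/-- The smoothed sum of Lemma 8.3: `∑_{d<z} μ(d)² g(d) G(log d/log z)` (`d < z` as `d < ⌈z⌉₊`).
[cite: Maynard2016DenseClusters, Lemma 8.3] -/
def smoothedSum (γ : ℕ → ℝ) (G : ℝ → ℝ) (z : ℝ) : ℝ :=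
  ∑ d ∈ Finset.Ico 1 ⌈z⌉₊, ((μ d : ℤ) : ℝ) ^ 2 * GGPY.g γ d * G (Real.log d / Real.log z)

/-- The change of variable `F(u) = G(1 − u)`: `∑ μ² g G(log d/log z) = ∑ μ² g F(log(z/d)/log z)` (`z ≥ 2`).
[cite: Maynard2016DenseClusters, Lemma 8.3 (proof: «slight changes to the notation»)] -/
theorem smoothedSum_eq_moebiusSqGSumWeighted (γ : ℕ → ℝ) (G : ℝ → ℝ) {z : ℝ} (hz : 2 ≤ z) :
    smoothedSum γ G z = GGPY.moebiusSqGSumWeighted γ (fun u => G (1 - u)) z := by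
  unfold smoothedSum GGPY.moebiusSqGSumWeighted
  refine Finset.sum_congr rfl fun d hd => ?_
  have hd1 : 1 ≤ d := (Finset.mem_Ico.1 hd).1
  have hd0 : (d : ℝ) ≠ 0 := by exact_mod_cast (show d ≠ 0 by omega)
  have hz0 : z ≠ 0 := by linarith
  have hlogz : Real.log z ≠ 0 := (Real.log_pos (by linarith)).ne'
  congr 1
  rw [Real.log_div hz0 hd0]
  field_simp
  ring

/-- **Maynard 2016, Lemma 8.3** (= GGPY Lemma 4 with `κ = 1`, PROVED in the tree): for `A₁', A₂ > 0` there
is `C` such that for every `L ≥ 1`, every `γ` with `GGPY.HypOmega1 γ A₁'` and `GGPY.HypOmega2 γ 1 A₂ L`,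
every `G ∈ C¹(ℝ)` and `G_max ≥ sup_{[0,1]} (|G| + |G'|)`, and every `z ≥ 2`:
`|∑_{d<z} μ(d)² g(d) G(log d/log z) − c_γ log z ∫₀¹ G| ≤ C c_γ L G_max`.
[cite: Maynard2016DenseClusters, Lemma 8.3] -/
theorem lemma83 (A₁ A₂ : ℝ) (hA₁ : 0 < A₁) (hA₂ : 0 < A₂) :
    ∃ C : ℝ, ∀ (L : ℝ), 1 ≤ L →
      ∀ (γ : ℕ → ℝ), GGPY.HypOmega1 γ A₁ → GGPY.HypOmega2 γ 1 A₂ L →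
      ∀ (G : ℝ → ℝ), ContDiff ℝ 1 G →
      ∀ (Gmax : ℝ), (∀ t ∈ Set.Icc (0 : ℝ) 1, |G t| + |deriv G t| ≤ Gmax) →
        ∀ z : ℝ, 2 ≤ z →
          |smoothedSum γ G z - GGPY.cGamma γ * Real.log z * ∫ x in (0 : ℝ)..1, G x| ≤
            C * GGPY.cGamma γ * L * Gmax := by
  obtain ⟨C, hC⟩ := GGPY.moebiusSqGSumWeighted_asymptotic_of GGPY.moebiusSqGSum_asymptotic_holds
    A₁ A₂ hA₁ hA₂
  refine ⟨C, fun L hL γ h1 h2 G hG Gmax hGmax z hz => ?_⟩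
  have hF : ContDiff ℝ 1 (fun u => G (1 - u)) := hG.comp (contDiff_const.sub contDiff_id)
  have hFmax : ∀ x ∈ Set.Icc (0 : ℝ) 1, |G (1 - x)| + |deriv (fun u => G (1 - u)) x| ≤ Gmax := by
    intro x hx
    rw [deriv_comp_const_sub, abs_neg]
    exact hGmax (1 - x) ⟨by linarith [hx.2], by linarith [hx.1]⟩
  have h := hC L hL γ h1 h2 (fun u => G (1 - u)) hF Gmax hFmax z hz
  simp only [sub_sub_cancel] at h
  rwa [smoothedSum_eq_moebiusSqGSumWeighted γ G hz]


/-! ## §2 The hypotheses check (8.13)–(8.14) of Lemma 8.4 -/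

/-- The multiplicative function (8.13) of the induction step of Lemma 8.4: `γ(p) = 0` if `p ∣ M`
(printed `M = W_{j+1} ∏_{i=j+2}^r e_i`) and `γ(p) = p/a_p` otherwise (printed `a_p = 1 + n_j(p) + g(p)`).
[cite: Maynard2016DenseClusters, proof of Lemma 8.4 (8.13)] -/
def gamma84 (M : ℕ) (a : ℕ → ℝ) (p : ℕ) : ℝ := if p ∣ M then 0 else (p : ℝ) / a p

/-- `γ(p) = 0` for `p ∣ M`. [cite: Maynard2016DenseClusters, proof of Lemma 8.4 (8.13)] -/
theorem gamma84_of_dvd {M : ℕ} (a : ℕ → ℝ) {p : ℕ} (h : p ∣ M) : gamma84 M a p = 0 := by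
  unfold gamma84; rw [if_pos h]

/-- `γ(p) = p/a_p` for `p ∤ M`. [cite: Maynard2016DenseClusters, proof of Lemma 8.4 (8.13)] -/
theorem gamma84_of_not_dvd {M : ℕ} (a : ℕ → ℝ) {p : ℕ} (h : ¬p ∣ M) : gamma84 M a p = p / a p := by
  unfold gamma84; rw [if_neg h]

/-- `(Ω₁)` with `A₁' = 2` (`0 ≤ γ(p)/p = 1/a_p ≤ 1/2`) as soon as `a_p ≥ 2` for the primes `p ∤ M`.
[cite: Maynard2016DenseClusters, proof of Lemma 8.4 («we can take A₁ and A₂ to be fixed constants»)] -/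
theorem hypOmega1_gamma84 {M : ℕ} {a : ℕ → ℝ} (ha : ∀ p : ℕ, p.Prime → ¬p ∣ M → 2 ≤ a p) :
    GGPY.HypOmega1 (gamma84 M a) 2 := by
  intro p hp
  have hp0 : (0 : ℝ) < p := by exact_mod_cast hp.pos
  by_cases h : p ∣ M
  · rw [gamma84_of_dvd a h, zero_div]; norm_num
  · have h2 := ha p hp h
    rw [gamma84_of_not_dvd a h, show (p : ℝ) / a p / p = 1 / a p by field_simp]
    refine ⟨by positivity, ?_⟩
    rw [div_le_iff₀ (by linarith)]
    linarith

/-- Termwise comparison with `γ₀ = 1_{p ∤ M}`: for a prime `p ∤ M` with `|a_p − p| ≤ K ≤ p/4`,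
`|γ(p) log p/p − log p/p| = log p·|p − a_p|/(p a_p) ≤ (4K/3)(1 + log p)/p²`.
[cite: Maynard2016DenseClusters, proof of Lemma 8.4 (8.14) («∑_{p>2k²} k log p/p²»)] -/
theorem abs_gamma84_term_sub_le {M : ℕ} {K : ℝ} {a : ℕ → ℝ} {p : ℕ} (hp : p.Prime) (hpM : ¬p ∣ M)
    (haK : |a p - p| ≤ K) (h4 : 4 * K ≤ p) :
    |gamma84 M a p * Real.log p / p - gammaInd M p * Real.log p / p| ≤
      4 / 3 * K * ((1 + Real.log p) / (p : ℝ) ^ 2) := by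
  have hp0 : (0 : ℝ) < p := by exact_mod_cast hp.pos
  have hp2 : (2 : ℝ) ≤ p := by exact_mod_cast hp.two_le
  have hK : 0 ≤ K := (abs_nonneg _).trans haK
  have hapos : 3 / 4 * (p : ℝ) ≤ a p := by have := (abs_le.1 haK).1; linarith
  have ha0 : 0 < a p := by linarith
  have hlogp : 0 ≤ Real.log p := Real.log_nonneg (by linarith)
  rw [gamma84_of_not_dvd a hpM, gammaInd, if_neg hpM]
  have heq : (p : ℝ) / a p * Real.log p / p - 1 * Real.log p / p =
      Real.log p * ((p - a p) / (p * a p)) := by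
    field_simp
  rw [heq, abs_mul, abs_of_nonneg hlogp, abs_div, abs_of_pos (by positivity : (0 : ℝ) < p * a p),
    abs_sub_comm]
  have h1 : |a p - (p : ℝ)| / (p * a p) ≤ K / (p * (3 / 4 * p)) :=
    (div_le_div_of_nonneg_right haK (by positivity)).trans
      (div_le_div_of_nonneg_left hK (by positivity) (mul_le_mul_of_nonneg_left hapos hp0.le))
  calc Real.log p * (|a p - (p : ℝ)| / (p * a p)) ≤ Real.log p * (K / (p * (3 / 4 * p))) :=
        mul_le_mul_of_nonneg_left h1 hlogp
    _ = 4 / 3 * K * (Real.log p / (p : ℝ) ^ 2) := by field_simp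
    _ ≤ 4 / 3 * K * ((1 + Real.log p) / (p : ℝ) ^ 2) := by
        gcongr
        linarith

/-- The `(Ω₂)`-sums of `γ` and of `γ₀ = 1_{p ∤ M}` differ by at most `(4K/3)(2 + log H)/H`, when every prime
`p ∤ M` satisfies `p > H ≥ 1`, `p ≥ 4K` and `|a_p − p| ≤ K`.
[cite: Maynard2016DenseClusters, proof of Lemma 8.4 (8.14)] -/
theorem abs_omega2Sum_gamma84_sub_le {M H : ℕ} (hH : 1 ≤ H) {K : ℝ} (hK : 0 ≤ K) {a : ℕ → ℝ}
    (ha : ∀ p : ℕ, p.Prime → ¬p ∣ M → |a p - p| ≤ K ∧ 4 * K ≤ p ∧ H < p) (w z : ℝ) :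
    |GGPY.omega2Sum (gamma84 M a) w z - GGPY.omega2Sum (gammaInd M) w z| ≤
      4 / 3 * K * ((2 + Real.log H) / H) := by
  unfold GGPY.omega2Sum
  rw [← Finset.sum_sub_distrib]
  set S := (Finset.Ico ⌈w⌉₊ ⌈z⌉₊).filter Nat.Prime with hS
  have hterm : ∀ p ∈ S, |gamma84 M a p * Real.log p / p - gammaInd M p * Real.log p / p| ≤
      if p ∣ M then 0 else 4 / 3 * K * ((1 + Real.log p) / (p : ℝ) ^ 2) := by
    intro p hp
    have hpr : p.Prime := (Finset.mem_filter.1 hp).2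
    by_cases hpM : p ∣ M
    · rw [if_pos hpM, gamma84_of_dvd a hpM, gammaInd, if_pos hpM]; simp
    · rw [if_neg hpM]
      obtain ⟨haK, h4, -⟩ := ha p hpr hpM
      exact abs_gamma84_term_sub_le hpr hpM haK h4
  have hsub : S.filter (fun p => ¬p ∣ M) ⊆ Finset.Ioc H ⌈z⌉₊ := by
    intro p hp
    rw [Finset.mem_filter] at hp
    have hpS := Finset.mem_filter.1 hp.1
    have hlt : H < p := (ha p hpS.2 hp.2).2.2
    exact Finset.mem_Ioc.2 ⟨hlt, (Finset.mem_Ico.1 hpS.1).2.le⟩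
  calc |∑ p ∈ S, (gamma84 M a p * Real.log p / p - gammaInd M p * Real.log p / p)|
      ≤ ∑ p ∈ S, |gamma84 M a p * Real.log p / p - gammaInd M p * Real.log p / p| :=
        Finset.abs_sum_le_sum_abs _ _
    _ ≤ ∑ p ∈ S, (if p ∣ M then 0 else 4 / 3 * K * ((1 + Real.log p) / (p : ℝ) ^ 2)) :=
        Finset.sum_le_sum hterm
    _ = ∑ p ∈ S.filter (fun p => ¬p ∣ M), 4 / 3 * K * ((1 + Real.log p) / (p : ℝ) ^ 2) := by
        conv_rhs => rw [Finset.sum_filter]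
        exact Finset.sum_congr rfl fun p _ => by by_cases h : p ∣ M <;> simp [h]
    _ ≤ ∑ h ∈ Finset.Ioc H ⌈z⌉₊, 4 / 3 * K * ((1 + Real.log h) / (h : ℝ) ^ 2) := by
        refine Finset.sum_le_sum_of_subset_of_nonneg hsub fun h hh _ => ?_
        have h1 : (1 : ℝ) ≤ h := by
          have : H < h := (Finset.mem_Ioc.1 hh).1
          exact_mod_cast (show 1 ≤ h by omega)
        have : 0 ≤ Real.log h := Real.log_nonneg h1
        positivity
    _ = 4 / 3 * K * ∑ h ∈ Finset.Ioc H ⌈z⌉₊, (1 + Real.log h) / (h : ℝ) ^ 2 := by rw [Finset.mul_sum]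
    _ ≤ 4 / 3 * K * ((2 + Real.log H) / H) :=
        mul_le_mul_of_nonneg_left
          (LFunctions.ConreyIwaniec2002.Thm61DivisorMoments.sum_Ioc_log_div_sq_le hH _) (by positivity)

/-- **(8.13)–(8.14)**: `(Ω₂)` for `γ` with `κ = 1`, `A₂ = 10 + E`, `L = 6 + ∑_{p ∣ M} log p/p + E`,
`E = (4K/3)(2 + log H)/H`, from the tree's `(Ω₂)` for `γ₀ = 1_{p ∤ M}` (`hypOmega2_gammaInd`).
[cite: Maynard2016DenseClusters, proof of Lemma 8.4 (8.13)–(8.14)] -/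
theorem hypOmega2_gamma84 {M H : ℕ} (hM : M ≠ 0) (hH : 1 ≤ H) {K : ℝ} (hK : 0 ≤ K) {a : ℕ → ℝ}
    (ha : ∀ p : ℕ, p.Prime → ¬p ∣ M → |a p - p| ≤ K ∧ 4 * K ≤ p ∧ H < p) :
    GGPY.HypOmega2 (gamma84 M a) 1 (10 + 4 / 3 * K * ((2 + Real.log H) / H))
      (6 + ∑ p ∈ M.primeFactors, Real.log p / p + 4 / 3 * K * ((2 + Real.log H) / H)) := by
  intro w z hw hwz
  have h0 := hypOmega2_gammaInd hM w z hw hwz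
  have hd := abs_le.1 (abs_omega2Sum_gamma84_sub_le hH hK ha w z)
  constructor <;> linarith [h0.1, h0.2, hd.1, hd.2]

/-- **The hypotheses of Lemma 8.3 in the induction step of Lemma 8.4, with fixed constants**: if `M ≠ 0` is a
multiple of every prime `p ≤ 2K²` (`K ≥ 2`) and `|a_p − p| ≤ K` for the primes `p ∤ M`, then `γ` satisfies
`(Ω₁)` with `A₁' = 2` and `(Ω₂)` with `κ = 1`, `A₂ = 13`, `L = 9 + ∑_{p ∣ M} log p/p` («we can take `A₁` and
`A₂` to be fixed constants… `L ≪ 1 + ∑_{p ∣ W_{j+1}∏e_i} log p/p + ∑_{p>2k²} k log p/p²`»; with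
`sum_primeFactors_log_div_le`: `L ≤ 9 + log T + log 4 + log M/T`, i.e. `L ≪ log log R` for `M ≤ R^{O(k²)}`,
`T = log R`). [cite: Maynard2016DenseClusters, proof of Lemma 8.4 (8.13)–(8.14)] -/
theorem hyp_gamma84 {M : ℕ} (hM : M ≠ 0) {K : ℝ} (hK : 2 ≤ K) {a : ℕ → ℝ}
    (ha : ∀ p : ℕ, p.Prime → ¬p ∣ M → |a p - p| ≤ K)
    (hsmall : ∀ p : ℕ, p.Prime → (p : ℝ) ≤ 2 * K ^ 2 → p ∣ M) :
    GGPY.HypOmega1 (gamma84 M a) 2 ∧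
      GGPY.HypOmega2 (gamma84 M a) 1 13 (9 + ∑ p ∈ M.primeFactors, Real.log p / p) := by
  have hK0 : 0 < K := by linarith
  -- every prime `p ∤ M` is `> 2K²`
  have hbig : ∀ p : ℕ, p.Prime → ¬p ∣ M → 2 * K ^ 2 < (p : ℝ) := fun p hp hpM => by
    by_contra h
    exact hpM (hsmall p hp (not_lt.1 h))
  set H : ℕ := ⌊2 * K ^ 2⌋₊ with hHdef
  have hH8 : 8 ≤ H := Nat.le_floor (by push_cast; nlinarith)
  have hH1 : 1 ≤ H := le_trans (by norm_num) hH8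
  have hHle : (H : ℝ) ≤ 2 * K ^ 2 := Nat.floor_le (by positivity)
  have hHgt : 2 * K ^ 2 - 1 < (H : ℝ) := by
    have := Nat.lt_floor_add_one (2 * K ^ 2); linarith
  have hHpos : (0 : ℝ) < H := by exact_mod_cast (show 0 < H by omega)
  have ha' : ∀ p : ℕ, p.Prime → ¬p ∣ M → |a p - p| ≤ K ∧ 4 * K ≤ p ∧ H < p := fun p hp hpM => by
    have hb := hbig p hp hpM
    refine ⟨ha p hp hpM, by nlinarith, ?_⟩
    exact_mod_cast (show (H : ℝ) < p by linarith)
  -- the tail constant `E = (4K/3)(2 + log H)/H ≤ 8/3`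
  have hKs : K ≤ Real.sqrt H := Real.le_sqrt_of_sq_le (by nlinarith)  -- K² ≤ H
  have hsH : Real.sqrt H * Real.sqrt H = H := Real.mul_self_sqrt hHpos.le
  have hlog : Real.log H ≤ 2 * Real.sqrt H - 2 := by
    have h := Real.log_le_sub_one_of_pos (Real.sqrt_pos.2 hHpos)
    rw [Real.log_sqrt hHpos.le] at h
    linarith
  have hE : 4 / 3 * K * ((2 + Real.log H) / H) ≤ 3 := by
    have h1 : (2 + Real.log H) / H ≤ 2 / K := by
      rw [div_le_iff₀ hHpos]
      have h2 : Real.sqrt H * K ≤ H :=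
        calc Real.sqrt H * K ≤ Real.sqrt H * Real.sqrt H :=
              mul_le_mul_of_nonneg_left hKs (Real.sqrt_nonneg _)
          _ = H := hsH
      have h3 : Real.sqrt H ≤ H / K := by rw [le_div_iff₀ hK0]; exact h2
      have h4 : 2 / K * (H : ℝ) = 2 * (H / K) := by ring
      rw [h4]
      linarith
    calc 4 / 3 * K * ((2 + Real.log H) / H) ≤ 4 / 3 * K * (2 / K) :=
          mul_le_mul_of_nonneg_left h1 (by positivity)
      _ = 8 / 3 := by field_simp; ring
      _ ≤ 3 := by norm_num
  refine ⟨hypOmega1_gamma84 fun p hp hpM => ?_, ?_⟩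
  · have := (abs_le.1 (ha p hp hpM)).1
    have := hbig p hp hpM
    nlinarith
  · exact GGPY.Lemma3.hypOmega2_mono (by linarith) (by linarith) (hypOmega2_gamma84 hM hH1 hK0.le ha')

/-- **Lemma 8.3 for the `γ` of Lemma 8.4's induction step** (constants independent of `M`, `a`, hence of
`j, k, r, x`): there is an absolute `C` such that for all such `M`, `a` (`K ≥ 2`), every `G ∈ C¹(ℝ)` with
`|G| + |G'| ≤ G_max` on `[0,1]` and every `z ≥ 2`,
`|∑_{d<z} μ(d)² g(d) G(log d/log z) − c_γ log z ∫₀¹ G| ≤ C c_γ (9 + ∑_{p ∣ M} log p/p) G_max`.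
[cite: Maynard2016DenseClusters, proof of Lemma 8.4 (8.13)–(8.19)] -/
theorem lemma83_gamma84 :
    ∃ C : ℝ, ∀ (M : ℕ), M ≠ 0 → ∀ (K : ℝ), 2 ≤ K → ∀ (a : ℕ → ℝ),
      (∀ p : ℕ, p.Prime → ¬p ∣ M → |a p - p| ≤ K) → (∀ p : ℕ, p.Prime → (p : ℝ) ≤ 2 * K ^ 2 → p ∣ M) →
      ∀ (G : ℝ → ℝ), ContDiff ℝ 1 G →
      ∀ (Gmax : ℝ), (∀ t ∈ Set.Icc (0 : ℝ) 1, |G t| + |deriv G t| ≤ Gmax) →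
        ∀ z : ℝ, 2 ≤ z →
          |smoothedSum (gamma84 M a) G z -
              GGPY.cGamma (gamma84 M a) * Real.log z * ∫ x in (0 : ℝ)..1, G x| ≤
            C * GGPY.cGamma (gamma84 M a) * (9 + ∑ p ∈ M.primeFactors, Real.log p / p) * Gmax := by
  obtain ⟨C, hC⟩ := lemma83 2 13 (by norm_num) (by norm_num)
  refine ⟨C, fun M hM K hK a ha hsmall G hG Gmax hGmax z hz => ?_⟩
  obtain ⟨h1, h2⟩ := hyp_gamma84 hM hK ha hsmall
  have hL : (1 : ℝ) ≤ 9 + ∑ p ∈ M.primeFactors, Real.log p / p := by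
    have : 0 ≤ ∑ p ∈ M.primeFactors, Real.log p / p := Finset.sum_nonneg fun p hp => by
      have := (Nat.prime_of_mem_primeFactors hp).pos; positivity
    linarith
  exact hC _ hL _ h1 h2 G hG Gmax hGmax z hz

/-! ## §3 The constant `c_γ` under modification of `γ` at finitely many primes (the products `c_j` of (8.11), (8.18)) -/

/-- Partial products of `c_γ`: if `γ₁ = γ₂` at every prime outside a finite set `S` of primes, then for `y`
beyond `S`, `∏_{p<y}(1 − γ₂(p)/p)⁻¹(1 − 1/p) = ∏_{p<y}(1 − γ₁(p)/p)⁻¹(1 − 1/p) · ∏_{p ∈ S}(1 − γ₁(p)/p)/(1 − γ₂(p)/p)`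
(when the modified factors of `γ₁` are non-degenerate). [cite: Maynard2016DenseClusters, proof of Lemma 8.4 ((8.11): the products c_j, c_{j+1})] -/
theorem cGammaPartial_eq_mul_prod {γ₁ γ₂ : ℕ → ℝ} {S : Finset ℕ} (hS : ∀ p ∈ S, p.Prime)
    (heq : ∀ p : ℕ, p.Prime → p ∉ S → γ₁ p = γ₂ p) (hne : ∀ p ∈ S, 1 - γ₁ p / p ≠ 0)
    {y : ℕ} (hy : ∀ p ∈ S, p < y) :
    GGPY.cGammaPartial γ₂ y =
      GGPY.cGammaPartial γ₁ y * ∏ p ∈ S, (1 - γ₁ p / p) / (1 - γ₂ p / p) := by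
  unfold GGPY.cGammaPartial
  have hSsub : S ⊆ Nat.primesBelow y := fun p hp => Nat.mem_primesBelow.2 ⟨hy p hp, hS p hp⟩
  rw [← Finset.prod_sdiff hSsub, ← Finset.prod_sdiff hSsub, mul_assoc]
  congr 1
  · exact Finset.prod_congr rfl fun p hp => by
      have hp' := Finset.mem_sdiff.1 hp
      rw [heq p (Nat.mem_primesBelow.1 hp'.1).2 hp'.2]
  · rw [← Finset.prod_mul_distrib]
    exact Finset.prod_congr rfl fun p hp => by
      have h1 := hne p hp
      by_cases h2 : 1 - γ₂ p / p = 0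
      · rw [h2]; simp
      · field_simp

/-- Hence, if the partial products of `c_{γ₁}` converge, so do those of `c_{γ₂}`, and
`c_{γ₂} = c_{γ₁} · ∏_{p ∈ S}(1 − γ₁(p)/p)/(1 − γ₂(p)/p)`.
[cite: Maynard2016DenseClusters, proof of Lemma 8.4 ((8.11), (8.18): «we obtain the same expression…»)] -/
theorem cGamma_eq_mul_prod {γ₁ γ₂ : ℕ → ℝ} {S : Finset ℕ} (hS : ∀ p ∈ S, p.Prime)
    (heq : ∀ p : ℕ, p.Prime → p ∉ S → γ₁ p = γ₂ p) (hne : ∀ p ∈ S, 1 - γ₁ p / p ≠ 0)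
    (h₁ : Tendsto (GGPY.cGammaPartial γ₁) atTop (𝓝 (GGPY.cGamma γ₁))) :
    Tendsto (GGPY.cGammaPartial γ₂) atTop
        (𝓝 (GGPY.cGamma γ₁ * ∏ p ∈ S, (1 - γ₁ p / p) / (1 - γ₂ p / p))) ∧
      GGPY.cGamma γ₂ = GGPY.cGamma γ₁ * ∏ p ∈ S, (1 - γ₁ p / p) / (1 - γ₂ p / p) := by
  have hev : (fun y => GGPY.cGammaPartial γ₁ y * ∏ p ∈ S, (1 - γ₁ p / p) / (1 - γ₂ p / p)) =ᶠ[atTop]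
      GGPY.cGammaPartial γ₂ := by
    refine Filter.eventually_atTop.2 ⟨S.sup id + 1, fun y hy => ?_⟩
    exact (cGammaPartial_eq_mul_prod hS heq hne fun p hp => by
      have : id p ≤ S.sup id := Finset.le_sup hp
      simp only [id] at this
      omega).symm
  have ht : Tendsto (GGPY.cGammaPartial γ₂) atTop
      (𝓝 (GGPY.cGamma γ₁ * ∏ p ∈ S, (1 - γ₁ p / p) / (1 - γ₂ p / p))) :=
    (h₁.mul_const _).congr' hev
  exact ⟨ht, ht.limUnder_eq⟩

/-- **`c_γ` for the `γ` of (8.13) when `M` is enlarged**: for `M, E ≠ 0`, `γ_{ME}` and `γ_M` differ exactly at the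
primes `p ∣ E`, `p ∤ M` (there `γ_{ME}(p) = 0`, `γ_M(p) = p/a_p`), so — if the partial products of `c_{γ_M}`
converge (Lemma 8.3's hypotheses, `hyp_gamma84` with `GGPY.moebiusSqGSum_asymptotic_holds`) and `a_p ≠ 1`
there — `c_{γ_{ME}} = c_{γ_M} · ∏_{p ∣ E, p ∤ M} (1 − 1/a_p)` (the finite Euler factors that turn
`1/g_j(e_{j+2}⋯e_r)` into `1/g_{j+1}(e_{j+2}⋯e_r)` in (8.11)).
[cite: Maynard2016DenseClusters, proof of Lemma 8.4 ((8.11), (8.13), (8.18))] -/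
theorem cGamma_gamma84_mul {M E : ℕ} (hE : E ≠ 0) {a : ℕ → ℝ}
    (ha1 : ∀ p : ℕ, p.Prime → p ∣ E → ¬p ∣ M → a p ≠ 1)
    (hconv : Tendsto (GGPY.cGammaPartial (gamma84 M a)) atTop (𝓝 (GGPY.cGamma (gamma84 M a)))) :
    Tendsto (GGPY.cGammaPartial (gamma84 (M * E) a)) atTop (𝓝 (GGPY.cGamma (gamma84 (M * E) a))) ∧
      GGPY.cGamma (gamma84 (M * E) a) =
        GGPY.cGamma (gamma84 M a) * ∏ p ∈ E.primeFactors.filter (fun p => ¬p ∣ M), (1 - 1 / a p) := by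
  set S := E.primeFactors.filter (fun p => ¬p ∣ M) with hSdef
  have hS : ∀ p ∈ S, p.Prime := fun p hp =>
    Nat.prime_of_mem_primeFactors (Finset.mem_filter.1 hp).1
  have heq : ∀ p : ℕ, p.Prime → p ∉ S → gamma84 M a p = gamma84 (M * E) a p := by
    intro p hp hpS
    by_cases hpM : p ∣ M
    · rw [gamma84_of_dvd a hpM, gamma84_of_dvd a (dvd_mul_of_dvd_left hpM E)]
    · have hpE : ¬p ∣ E := fun h =>
        hpS (Finset.mem_filter.2 ⟨Nat.mem_primeFactors.2 ⟨hp, h, hE⟩, hpM⟩)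
      have hpME : ¬p ∣ M * E := fun h => (hp.dvd_mul.1 h).elim hpM hpE
      rw [gamma84_of_not_dvd a hpM, gamma84_of_not_dvd a hpME]
  have hne : ∀ p ∈ S, 1 - gamma84 M a p / p ≠ 0 := by
    intro p hp
    have hp' := Finset.mem_filter.1 hp
    have hpr := Nat.prime_of_mem_primeFactors hp'.1
    have hp0 : (p : ℝ) ≠ 0 := by exact_mod_cast hpr.ne_zero
    have ha := ha1 p hpr (Nat.dvd_of_mem_primeFactors hp'.1) hp'.2
    rw [gamma84_of_not_dvd a hp'.2]
    by_cases ha0 : a p = 0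
    · rw [ha0]; simp
    · rw [show (p : ℝ) / a p / p = 1 / a p by field_simp]
      intro h
      apply ha
      field_simp at h
      linarith
  have hprod : ∏ p ∈ S, (1 - gamma84 M a p / p) / (1 - gamma84 (M * E) a p / p) =
      ∏ p ∈ S, (1 - 1 / a p) := by
    refine Finset.prod_congr rfl fun p hp => ?_
    have hp' := Finset.mem_filter.1 hp
    have hpr := Nat.prime_of_mem_primeFactors hp'.1
    have hp0 : (p : ℝ) ≠ 0 := by exact_mod_cast hpr.ne_zero
    have hpME : p ∣ M * E := dvd_mul_of_dvd_right (Nat.dvd_of_mem_primeFactors hp'.1) M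
    rw [gamma84_of_not_dvd a hp'.2, gamma84_of_dvd a hpME, zero_div, sub_zero, div_one]
    by_cases ha0 : a p = 0
    · rw [ha0]; simp
    · rw [show (p : ℝ) / a p / p = 1 / a p by field_simp]
  obtain ⟨ht, hc⟩ := cGamma_eq_mul_prod hS heq hne hconv
  rw [hprod] at ht hc
  exact ⟨hc ▸ ht, hc⟩

/-- The partial products of `c_γ` converge for the `γ` of (8.13) under the hypotheses of `hyp_gamma84`
(from the tree's PROVED GGPY Lemma 3, `GGPY.moebiusSqGSum_asymptotic_holds`).
[cite: Maynard2016DenseClusters, proof of Lemma 8.4 (8.13)–(8.18)] -/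
theorem tendsto_cGammaPartial_gamma84 {M : ℕ} (hM : M ≠ 0) {K : ℝ} (hK : 2 ≤ K) {a : ℕ → ℝ}
    (ha : ∀ p : ℕ, p.Prime → ¬p ∣ M → |a p - p| ≤ K)
    (hsmall : ∀ p : ℕ, p.Prime → (p : ℝ) ≤ 2 * K ^ 2 → p ∣ M) :
    Tendsto (GGPY.cGammaPartial (gamma84 M a)) atTop (𝓝 (GGPY.cGamma (gamma84 M a))) := by
  obtain ⟨C, hC⟩ := GGPY.moebiusSqGSum_asymptotic_holds 2 13 (by norm_num) (by norm_num)
  obtain ⟨h1, h2⟩ := hyp_gamma84 hM hK ha hsmall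
  have hL : (1 : ℝ) ≤ 9 + ∑ p ∈ M.primeFactors, Real.log p / p := by
    have : 0 ≤ ∑ p ∈ M.primeFactors, Real.log p / p := Finset.sum_nonneg fun p hp => by
      have := (Nat.prime_of_mem_primeFactors hp).pos; positivity
    linarith
  exact (hC _ hL _ h1 h2).1

/-! ## §4 (8.13)–(8.14) with the threshold decoupled from the deviation: primes `≤ 2K₀²` divide `M`, `|a_p − p| ≤ K₁ ≤ K₀²` -/

/-- Termwise comparison with `γ₀ = 1_{p ∤ M}`, second form: for a prime `p ∤ M` with `|a_p − p| ≤ K₁` and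
`2K₁ ≤ p` (so `a_p ≥ p/2`), `|γ(p) log p/p − log p/p| = log p·|p − a_p|/(p a_p) ≤ 2K₁ log p/p²`.
[cite: Maynard2016DenseClusters, proof of Lemma 8.4 (8.13)–(8.14) («γ(p) = 1 + O(k/p)», «∑_{p>2k²} k log p/p²»)] -/
theorem abs_gamma84_term_sub_le_two {M : ℕ} {K₁ : ℝ} {a : ℕ → ℝ} {p : ℕ} (hp : p.Prime) (hpM : ¬p ∣ M)
    (haK : |a p - p| ≤ K₁) (h2 : 2 * K₁ ≤ p) :
    |gamma84 M a p * Real.log p / p - gammaInd M p * Real.log p / p| ≤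
      2 * K₁ * (Real.log p / (p : ℝ) ^ 2) := by
  have hp0 : (0 : ℝ) < p := by exact_mod_cast hp.pos
  have hp2 : (2 : ℝ) ≤ p := by exact_mod_cast hp.two_le
  have hK : 0 ≤ K₁ := (abs_nonneg _).trans haK
  have hapos : (p : ℝ) / 2 ≤ a p := by have := (abs_le.1 haK).1; linarith
  have ha0 : 0 < a p := by linarith
  have hlogp : 0 ≤ Real.log p := Real.log_nonneg (by linarith)
  rw [gamma84_of_not_dvd a hpM, gammaInd, if_neg hpM]
  have heq : (p : ℝ) / a p * Real.log p / p - 1 * Real.log p / p =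
      Real.log p * ((p - a p) / (p * a p)) := by
    field_simp
  rw [heq, abs_mul, abs_of_nonneg hlogp, abs_div, abs_of_pos (by positivity : (0 : ℝ) < p * a p),
    abs_sub_comm]
  have h1 : |a p - (p : ℝ)| / (p * a p) ≤ K₁ / (p * (p / 2)) :=
    (div_le_div_of_nonneg_right haK (by positivity)).trans
      (div_le_div_of_nonneg_left hK (by positivity) (mul_le_mul_of_nonneg_left hapos hp0.le))
  calc Real.log p * (|a p - (p : ℝ)| / (p * a p)) ≤ Real.log p * (K₁ / (p * (p / 2))) :=
        mul_le_mul_of_nonneg_left h1 hlogp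
    _ = 2 * K₁ * (Real.log p / (p : ℝ) ^ 2) := by
        field_simp

/-- **Chebyshev's prime tail** (the printed `∑_{p>2k²} k log p/p² ≪ 1`, over PRIMES): for a natural `H ≥ 2` and any
finite set `s` of naturals, `∑_{p ∈ s prime, p > H} log p/p² ≤ 3 log 4/H` (the tree's partial summation against
`ϑ(x) ≤ x log 4`, `LFunctions.sum_Ioc_prime_log_mul_rpow_le` with `σ = 2`).
[cite: Maynard2016DenseClusters, proof of Lemma 8.4 (8.14) («∑_{p>2k²} k log p/p²»)] -/
theorem sum_filter_prime_gt_log_div_sq_le {H : ℕ} (hH : 2 ≤ H) (s : Finset ℕ) :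
    ∑ p ∈ s.filter (fun p => p.Prime ∧ H < p), Real.log p / (p : ℝ) ^ 2 ≤ 3 * Real.log 4 / H := by
  set N := max H (s.sup id) with hN
  have hsub : s.filter (fun p => p.Prime ∧ H < p) ⊆ (Finset.Ioc H N).filter Nat.Prime := by
    intro p hp
    rw [Finset.mem_filter] at hp ⊢
    refine ⟨Finset.mem_Ioc.2 ⟨hp.2.2, ?_⟩, hp.2.1⟩
    have : id p ≤ s.sup id := Finset.le_sup hp.1
    exact le_trans this (le_max_right _ _)
  have hnn : ∀ p ∈ (Finset.Ioc H N).filter Nat.Prime, 0 ≤ Real.log p / (p : ℝ) ^ 2 := fun p hp => by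
    have h1 : 1 ≤ p := (Finset.mem_filter.1 hp).2.one_lt.le
    have : (1 : ℝ) ≤ p := by exact_mod_cast h1
    have : 0 ≤ Real.log p := Real.log_nonneg this
    positivity
  have hHpos : (0 : ℝ) < H := by exact_mod_cast (show 0 < H by omega)
  calc ∑ p ∈ s.filter (fun p => p.Prime ∧ H < p), Real.log p / (p : ℝ) ^ 2
      ≤ ∑ p ∈ (Finset.Ioc H N).filter Nat.Prime, Real.log p / (p : ℝ) ^ 2 :=
        Finset.sum_le_sum_of_subset_of_nonneg hsub fun p hp _ => hnn p hp
    _ = ∑ p ∈ (Finset.Ioc H N).filter Nat.Prime, Real.log p * (p : ℝ) ^ (-(2 : ℝ)) := by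
        refine Finset.sum_congr rfl fun p hp => ?_
        have hp0 : (0 : ℝ) ≤ p := Nat.cast_nonneg _
        rw [Real.rpow_neg hp0, Real.rpow_two, div_eq_mul_inv]
    _ ≤ 3 * Real.log 4 * (H : ℝ) ^ (1 - (2 : ℝ)) / ((2 : ℝ) - 1) :=
        LFunctions.sum_Ioc_prime_log_mul_rpow_le (σ := 2) (by norm_num) le_rfl hH (le_max_left _ _)
    _ = 3 * Real.log 4 / H := by
        rw [show (1 : ℝ) - 2 = -1 by norm_num, Real.rpow_neg_one, show (2 : ℝ) - 1 = 1 by norm_num, div_one,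
          div_eq_mul_inv]

/-- The `(Ω₂)`-sums of `γ` and of `γ₀ = 1_{p ∤ M}` differ by at most `2K₁ · 3 log 4/H` when every prime `p ∤ M`
satisfies `p > H ≥ 2`, `p ≥ 2K₁` and `|a_p − p| ≤ K₁` (`K₁ ≥ 0`).
[cite: Maynard2016DenseClusters, proof of Lemma 8.4 (8.14)] -/
theorem abs_omega2Sum_gamma84_sub_le_two {M H : ℕ} (hH : 2 ≤ H) {K₁ : ℝ} (hK : 0 ≤ K₁) {a : ℕ → ℝ}
    (ha : ∀ p : ℕ, p.Prime → ¬p ∣ M → |a p - p| ≤ K₁ ∧ 2 * K₁ ≤ p ∧ H < p) (w z : ℝ) :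
    |GGPY.omega2Sum (gamma84 M a) w z - GGPY.omega2Sum (gammaInd M) w z| ≤
      2 * K₁ * (3 * Real.log 4 / H) := by
  unfold GGPY.omega2Sum
  rw [← Finset.sum_sub_distrib]
  set S := (Finset.Ico ⌈w⌉₊ ⌈z⌉₊).filter Nat.Prime with hS
  have hterm : ∀ p ∈ S, |gamma84 M a p * Real.log p / p - gammaInd M p * Real.log p / p| ≤
      if p ∣ M then 0 else 2 * K₁ * (Real.log p / (p : ℝ) ^ 2) := by
    intro p hp
    have hpr : p.Prime := (Finset.mem_filter.1 hp).2
    by_cases hpM : p ∣ M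
    · rw [if_pos hpM, gamma84_of_dvd a hpM, gammaInd, if_pos hpM]; simp
    · rw [if_neg hpM]
      obtain ⟨haK, h2, -⟩ := ha p hpr hpM
      exact abs_gamma84_term_sub_le_two hpr hpM haK h2
  have hsub : S.filter (fun p => ¬p ∣ M) ⊆ S.filter (fun p => p.Prime ∧ H < p) := by
    intro p hp
    rw [Finset.mem_filter] at hp ⊢
    have hpS := Finset.mem_filter.1 hp.1
    exact ⟨hp.1, hpS.2, (ha p hpS.2 hp.2).2.2⟩
  calc |∑ p ∈ S, (gamma84 M a p * Real.log p / p - gammaInd M p * Real.log p / p)|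
      ≤ ∑ p ∈ S, |gamma84 M a p * Real.log p / p - gammaInd M p * Real.log p / p| :=
        Finset.abs_sum_le_sum_abs _ _
    _ ≤ ∑ p ∈ S, (if p ∣ M then 0 else 2 * K₁ * (Real.log p / (p : ℝ) ^ 2)) :=
        Finset.sum_le_sum hterm
    _ = ∑ p ∈ S.filter (fun p => ¬p ∣ M), 2 * K₁ * (Real.log p / (p : ℝ) ^ 2) := by
        conv_rhs => rw [Finset.sum_filter]
        exact Finset.sum_congr rfl fun p _ => by by_cases h : p ∣ M <;> simp [h]
    _ ≤ ∑ p ∈ S.filter (fun p => p.Prime ∧ H < p), 2 * K₁ * (Real.log p / (p : ℝ) ^ 2) := by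
        refine Finset.sum_le_sum_of_subset_of_nonneg hsub fun p hp _ => ?_
        have h1 : (1 : ℝ) ≤ p := by exact_mod_cast (Finset.mem_filter.1 hp).2.1.one_lt.le
        have : 0 ≤ Real.log p := Real.log_nonneg h1
        positivity
    _ = 2 * K₁ * ∑ p ∈ S.filter (fun p => p.Prime ∧ H < p), Real.log p / (p : ℝ) ^ 2 := by
        rw [Finset.mul_sum]
    _ ≤ 2 * K₁ * (3 * Real.log 4 / H) :=
        mul_le_mul_of_nonneg_left (sum_filter_prime_gt_log_div_sq_le hH S) (by positivity)

/-- **(8.13)–(8.14), second form**: `(Ω₂)` for `γ` with `κ = 1`, `A₂ = 10 + E`, `L = 6 + ∑_{p ∣ M} log p/p + E`,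
`E = 2K₁ · 3 log 4/H`, from the tree's `(Ω₂)` for `γ₀ = 1_{p ∤ M}` (`hypOmega2_gammaInd`) and the PRIME tail.
[cite: Maynard2016DenseClusters, proof of Lemma 8.4 (8.13)–(8.14)] -/
theorem hypOmega2_gamma84_two {M H : ℕ} (hM : M ≠ 0) (hH : 2 ≤ H) {K₁ : ℝ} (hK : 0 ≤ K₁) {a : ℕ → ℝ}
    (ha : ∀ p : ℕ, p.Prime → ¬p ∣ M → |a p - p| ≤ K₁ ∧ 2 * K₁ ≤ p ∧ H < p) :
    GGPY.HypOmega2 (gamma84 M a) 1 (10 + 2 * K₁ * (3 * Real.log 4 / H))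
      (6 + ∑ p ∈ M.primeFactors, Real.log p / p + 2 * K₁ * (3 * Real.log 4 / H)) := by
  intro w z hw hwz
  have h0 := hypOmega2_gammaInd hM w z hw hwz
  have hd := abs_le.1 (abs_omega2Sum_gamma84_sub_le_two hH hK ha w z)
  constructor <;> linarith [h0.1, h0.2, hd.1, hd.2]

/-- **The hypotheses of Lemma 8.3 in the induction step of Lemma 8.4 — threshold and deviation DECOUPLED.**
If `M ≠ 0` is a multiple of every prime `p ≤ 2K₀²` (`K₀ ≥ 2`; printed: `W_i` a multiple of `∏_{p ≤ 2k²} p`) and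
`|a_p − p| ≤ K₁` for the primes `p ∤ M` with `K₁ ≤ K₀²` (printed: `a_p = 1 + n_j(p) + g(p) = p + O(k)`), then
`γ` satisfies `(Ω₁)` with `A₁' = 2` and `(Ω₂)` with `κ = 1`, `A₂ = 15`, `L = 11 + ∑_{p ∣ M} log p/p`: every prime
`p ∤ M` has `p > 2K₀² ≥ 2K₁`, so `a_p ≥ p/2` and `a_p > K₀² ≥ 4`, and the tail is
`2K₁ ∑_{p > 2K₀²} log p/p² ≤ 6 log 4 · K₁/⌊2K₀²⌋ ≤ (24/7) log 4 < 5` (prime tail, `sum_filter_prime_gt_log_div_sq_le`).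
This is the form the §9 applications need (`g(p) = p − ω(p) + O(1)`, `r = k`, threshold `2k²`: `K₀ = k`,
`K₁ = 2k + O(1) ≤ k²`); `hyp_gamma84` is the case `K₀ = K₁ = K` with the cruder integer tail.
[cite: Maynard2016DenseClusters, proof of Lemma 8.4 (8.13)–(8.14)] -/
theorem hyp_gamma84_dec {M : ℕ} (hM : M ≠ 0) {K₀ K₁ : ℝ} (hK₀ : 2 ≤ K₀) (hK₁ : K₁ ≤ K₀ ^ 2) {a : ℕ → ℝ}
    (ha : ∀ p : ℕ, p.Prime → ¬p ∣ M → |a p - p| ≤ K₁)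
    (hsmall : ∀ p : ℕ, p.Prime → (p : ℝ) ≤ 2 * K₀ ^ 2 → p ∣ M) :
    GGPY.HypOmega1 (gamma84 M a) 2 ∧
      GGPY.HypOmega2 (gamma84 M a) 1 15 (11 + ∑ p ∈ M.primeFactors, Real.log p / p) := by
  -- `K₁ ≥ 0`: there is a prime not dividing `M`
  obtain ⟨q, hqM, hq⟩ := Nat.exists_infinite_primes (M + 1)
  have hqndvd : ¬q ∣ M := fun h => by
    have := Nat.le_of_dvd (Nat.pos_of_ne_zero hM) h; omega
  have hK₁0 : 0 ≤ K₁ := (abs_nonneg _).trans (ha q hq hqndvd)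
  have hK₀sq : 4 ≤ K₀ ^ 2 := by nlinarith
  -- every prime `p ∤ M` is `> 2K₀²`
  have hbig : ∀ p : ℕ, p.Prime → ¬p ∣ M → 2 * K₀ ^ 2 < (p : ℝ) := fun p hp hpM => by
    by_contra h
    exact hpM (hsmall p hp (not_lt.1 h))
  set H : ℕ := ⌊2 * K₀ ^ 2⌋₊ with hHdef
  have hH8 : 8 ≤ H := Nat.le_floor (by push_cast; linarith)
  have hHle : (H : ℝ) ≤ 2 * K₀ ^ 2 := Nat.floor_le (by positivity)
  have hHgt : 2 * K₀ ^ 2 - 1 < (H : ℝ) := by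
    have := Nat.lt_floor_add_one (2 * K₀ ^ 2); linarith
  have hHpos : (0 : ℝ) < H := by exact_mod_cast (show 0 < H by omega)
  have ha' : ∀ p : ℕ, p.Prime → ¬p ∣ M → |a p - p| ≤ K₁ ∧ 2 * K₁ ≤ p ∧ H < p := fun p hp hpM => by
    have hb := hbig p hp hpM
    refine ⟨ha p hp hpM, by linarith, ?_⟩
    exact_mod_cast (show (H : ℝ) < p by linarith)
  -- the tail constant `E = 6 log 4 · K₁/H ≤ 5`
  have hlog4 : Real.log 4 < 1.3863 := by
    have h2 := Real.log_two_lt_d9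
    rw [show (4 : ℝ) = 2 ^ 2 by norm_num, Real.log_pow]
    push_cast
    linarith
  have hlog4pos : 0 < Real.log 4 := Real.log_pos (by norm_num)
  have h7 : 7 * K₁ ≤ 4 * (H : ℝ) := by linarith
  have hE : 2 * K₁ * (3 * Real.log 4 / H) ≤ 5 := by
    rw [show 2 * K₁ * (3 * Real.log 4 / H) = 6 * Real.log 4 * K₁ / H by ring, div_le_iff₀ hHpos]
    nlinarith [mul_nonneg hK₁0 hlog4pos.le]
  refine ⟨hypOmega1_gamma84 fun p hp hpM => ?_, ?_⟩
  · have := (abs_le.1 (ha p hp hpM)).1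
    have := hbig p hp hpM
    linarith
  · exact GGPY.Lemma3.hypOmega2_mono (by linarith) (by linarith)
      (hypOmega2_gamma84_two hM (le_trans (by norm_num) hH8) hK₁0 ha')

/-- The partial products of `c_γ` converge for the `γ` of (8.13) under the decoupled hypotheses of
`hyp_gamma84_dec` (from the tree's PROVED GGPY Lemma 3, `GGPY.moebiusSqGSum_asymptotic_holds`).
[cite: Maynard2016DenseClusters, proof of Lemma 8.4 (8.13)–(8.18)] -/
theorem tendsto_cGammaPartial_gamma84_dec {M : ℕ} (hM : M ≠ 0) {K₀ K₁ : ℝ} (hK₀ : 2 ≤ K₀)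
    (hK₁ : K₁ ≤ K₀ ^ 2) {a : ℕ → ℝ} (ha : ∀ p : ℕ, p.Prime → ¬p ∣ M → |a p - p| ≤ K₁)
    (hsmall : ∀ p : ℕ, p.Prime → (p : ℝ) ≤ 2 * K₀ ^ 2 → p ∣ M) :
    Tendsto (GGPY.cGammaPartial (gamma84 M a)) atTop (𝓝 (GGPY.cGamma (gamma84 M a))) := by
  obtain ⟨C, hC⟩ := GGPY.moebiusSqGSum_asymptotic_holds 2 15 (by norm_num) (by norm_num)
  obtain ⟨h1, h2⟩ := hyp_gamma84_dec hM hK₀ hK₁ ha hsmall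
  have hL : (1 : ℝ) ≤ 11 + ∑ p ∈ M.primeFactors, Real.log p / p := by
    have : 0 ≤ ∑ p ∈ M.primeFactors, Real.log p / p := Finset.sum_nonneg fun p hp => by
      have := (Nat.prime_of_mem_primeFactors hp).pos; positivity
    linarith
  exact (hC _ hL _ h1 h2).1

/-- **Lemma 8.3 for the `γ` of Lemma 8.4's induction step, decoupled form** (constants independent of `M`, `a`,
`K₀`, `K₁`): there is an absolute `C` such that for all `M ≠ 0` divisible by the primes `≤ 2K₀²` (`K₀ ≥ 2`), all `a`
with `|a_p − p| ≤ K₁ ≤ K₀²` at the primes `p ∤ M`, every `G ∈ C¹(ℝ)` with `|G| + |G'| ≤ G_max` on `[0,1]` and every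
`z ≥ 2`, `|∑_{d<z} μ(d)² g(d) G(log d/log z) − c_γ log z ∫₀¹ G| ≤ C c_γ (9 + ∑_{p ∣ M} log p/p) G_max` (the same
shape as `lemma83_gamma84`; the `L = 11 + ∑` of `hyp_gamma84_dec` is absorbed as `11 + ∑ ≤ (11/9)(9 + ∑)`).
[cite: Maynard2016DenseClusters, proof of Lemma 8.4 (8.13)–(8.19)] -/
theorem lemma83_gamma84_dec :
    ∃ C : ℝ, ∀ (M : ℕ), M ≠ 0 → ∀ (K₀ K₁ : ℝ), 2 ≤ K₀ → K₁ ≤ K₀ ^ 2 → ∀ (a : ℕ → ℝ),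
      (∀ p : ℕ, p.Prime → ¬p ∣ M → |a p - p| ≤ K₁) → (∀ p : ℕ, p.Prime → (p : ℝ) ≤ 2 * K₀ ^ 2 → p ∣ M) →
      ∀ (G : ℝ → ℝ), ContDiff ℝ 1 G →
      ∀ (Gmax : ℝ), (∀ t ∈ Set.Icc (0 : ℝ) 1, |G t| + |deriv G t| ≤ Gmax) →
        ∀ z : ℝ, 2 ≤ z →
          |smoothedSum (gamma84 M a) G z -
              GGPY.cGamma (gamma84 M a) * Real.log z * ∫ x in (0 : ℝ)..1, G x| ≤
            C * GGPY.cGamma (gamma84 M a) * (9 + ∑ p ∈ M.primeFactors, Real.log p / p) * Gmax := by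
  obtain ⟨C, hC⟩ := lemma83 2 15 (by norm_num) (by norm_num)
  refine ⟨max C 0 * (11 / 9), fun M hM K₀ K₁ hK₀ hK₁ a ha hsmall G hG Gmax hGmax z hz => ?_⟩
  obtain ⟨h1, h2⟩ := hyp_gamma84_dec hM hK₀ hK₁ ha hsmall
  set S := ∑ p ∈ M.primeFactors, Real.log p / p with hSdef
  have hS0 : 0 ≤ S := Finset.sum_nonneg fun p hp => by
    have := (Nat.prime_of_mem_primeFactors hp).pos; positivity
  have hL : (1 : ℝ) ≤ 11 + S := by linarith
  have h := hC _ hL _ h1 h2 G hG Gmax hGmax z hz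
  refine h.trans ?_
  have hc0 : 0 ≤ GGPY.cGamma (gamma84 M a) :=
    GGPY.cGamma_nonneg (by norm_num) h1 (tendsto_cGammaPartial_gamma84_dec hM hK₀ hK₁ ha hsmall)
  have hG0 : 0 ≤ Gmax := le_trans (by positivity) (hGmax 0 ⟨le_rfl, zero_le_one⟩)
  have hCle : C ≤ max C 0 := le_max_left _ _
  have hmax0 : 0 ≤ max C 0 := le_max_right _ _
  have hX : 0 ≤ GGPY.cGamma (gamma84 M a) * (11 + S) * Gmax := by positivity
  calc C * GGPY.cGamma (gamma84 M a) * (11 + S) * Gmax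
      ≤ max C 0 * GGPY.cGamma (gamma84 M a) * (11 + S) * Gmax := by nlinarith
    _ ≤ max C 0 * GGPY.cGamma (gamma84 M a) * (11 / 9 * (9 + S)) * Gmax := by
        have : 11 + S ≤ 11 / 9 * (9 + S) := by linarith
        have h2' : 0 ≤ max C 0 * GGPY.cGamma (gamma84 M a) := mul_nonneg hmax0 hc0
        gcongr
    _ = max C 0 * (11 / 9) * GGPY.cGamma (gamma84 M a) * (9 + S) * Gmax := by ring

end MaynardDense

end Literature.NumberTheory.Sieve
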